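import Summits.Ventures.PercRepro.ProfilePointedCircuitClassesStarSharpP
import Summits.Ventures.PercRepro.ProfilePointedCircuitClassesStarSharpU
import Summits.Ventures.PercRepro.ProfilePointedCircuitClassesStarSharpD3
import Summits.Ventures.PercRepro.ProfilePointedCircuitClassesStarSharpAsmB
import Summits.Ventures.PercRepro.ProfilePointedCircuitClassesStarSharpD0Dispatch

/-!
# PercRepro — THE ASSEMBLY OF `StarNineSharp`: THE PROP IS A THEOREM
(p5, gen 56; `proofs/P5-GM1.md` §84)

`starNineSharp_holds : StarNineSharp α` — the sharp (★) at `(9, 5)` along a series pair, for every coloop-free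
nine-point matroid of rank 5 with a series pair `{b, b′}` and two further points `e ≠ f`.  The case split: a loop
(every count vanishes); `e ∥ f` (the identity of StarSharpP); `f` a coloop of `R = N ∖ {b, b′}` (AsmA); `e` a coloop
of `R` (AsmA); `f` with a parallel twin in `X = E₇ − e − f` (StarSharpP); `e` with a parallel twin in `X` (case D1,
StarSharpD3); `{e, f}` a series pair of `R` (case A-ser, StarSharpV); `f` with a series twin `z ∈ X` — `z` a coloop
of `R` (AsmB) or not (case C, StarSharpU); and the generic case D0 (D0Dispatch: the seven regimes).
-/

open scoped Matroid

namespace PercRepro.Cogirth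

open Finset ThmH Skew Shadow Profile

open Classical

variable {α : Type} [DecidableEq α]

section StarSharpAsmC

/-- **THE SHARP (★) AT `(9, 5)` ALONG A SERIES PAIR IS A THEOREM.** -/
theorem starNineSharp_holds : StarNineSharp α := by
  intro N _ hn hR hcf b b' e f h he hf hef heb heb' hfb hfb'
  have hb : b ∈ gr N := h.1
  have hb' : b' ∈ gr N := h.2.1
  have hbb' : b ≠ b' := h.2.2.1
  have hE7 : rk N (((gr N).erase b).erase b') = 4 := by
    have := h.2.2.2.2.2
    rw [hR] at this
    omega
  have hE7g : ((gr N).erase b).erase b' ⊆ gr N := (erase_subset _ _).trans (erase_subset _ _)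
  have hfE : f ∈ ((gr N).erase b).erase b' := mem_erase.2 ⟨hfb', mem_erase.2 ⟨hfb, hf⟩⟩
  have heE : e ∈ ((gr N).erase b).erase b' := mem_erase.2 ⟨heb', mem_erase.2 ⟨heb, he⟩⟩
  have hXg : ((((gr N).erase b).erase b').erase f).erase e ⊆ gr N :=
    (erase_subset _ _).trans ((erase_subset _ _).trans hE7g)
  -- LOOPS
  by_cases hloop : ∃ x ∈ gr N, rk N {x} = 0
  · obtain ⟨x, hx, hx0⟩ := hloop
    exact inCount_thru_le_of_loop' hx hx0 b' e f
  push Not at hloop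
  have hpt : ∀ x ∈ gr N, rk N {x} = 1 := by
    intro x hx
    have h1 := rk_le_card' (M := N) ({x} : Finset α)
    rw [card_singleton] at h1
    have := hloop x hx
    omega
  have hpair : ∀ x ∈ gr N, ∀ y ∈ gr N, x ≠ y → rk N {x, y} = 1 ∨ rk N {x, y} = 2 := by
    intro x hx y hy hxy
    have h1 : rk N {x} ≤ rk N {x, y} := rk_mono' (singleton_subset_iff.2 (mem_insert_self _ _))
    have h2 := rk_le_card' (M := N) ({x, y} : Finset α)
    rw [card_pair hxy] at h2
    rw [hpt x hx] at h1
    omega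
  -- CASE A-par: `e ∥ f`
  by_cases hef1 : rk N {e, f} = 1
  · exact le_of_eq (inCount_thru_eq_of_parallel 4 he hf hef (hpt e he) (hpt f hf) hef1 heb'.symm hfb'.symm)
  have hef2 : rk N {e, f} = 2 := (hpair e he f hf hef).resolve_left hef1
  -- `f` A COLOOP OF `R`
  have hfR_bound : rk N ((((gr N).erase b).erase b').erase f) = 3 ∨ rk N ((((gr N).erase b).erase b').erase f) = 4 := by
    have h1 := rk_insert_le_add_one (N := N) hf (X := (((gr N).erase b).erase b').erase f) ((erase_subset _ _).trans hE7g)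
    rw [insert_erase hfE, hE7] at h1
    have h2 : rk N ((((gr N).erase b).erase b').erase f) ≤ rk N (((gr N).erase b).erase b') := rk_mono' (erase_subset _ _)
    rw [hE7] at h2
    omega
  rcases hfR_bound with hfR | hf'
  · exact inCount_thru_le_of_coloop_f hn hR hcf h hf hfb hfb' hE7 hfR
  -- `e` A COLOOP OF `R`
  have heR_bound : rk N ((((gr N).erase b).erase b').erase e) = 3 ∨ rk N ((((gr N).erase b).erase b').erase e) = 4 := by
    have h1 := rk_insert_le_add_one (N := N) he (X := (((gr N).erase b).erase b').erase e) ((erase_subset _ _).trans hE7g)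
    rw [insert_erase heE, hE7] at h1
    have h2 : rk N ((((gr N).erase b).erase b').erase e) ≤ rk N (((gr N).erase b).erase b') := rk_mono' (erase_subset _ _)
    rw [hE7] at h2
    omega
  rcases heR_bound with heR | he'
  · exact inCount_thru_le_of_coloop_e hn h hf hfb' heR
  -- CASE B: `f` has a parallel twin in `X`
  by_cases hB : ∃ y ∈ ((((gr N).erase b).erase b').erase f).erase e, rk N {f, y} = 1
  · obtain ⟨y, hyX, hfy⟩ := hB
    have hyg : y ∈ gr N := hXg hyX
    have hye : y ≠ e := (mem_erase.1 hyX).1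
    have hyf : y ≠ f := (mem_erase.1 (mem_erase.1 hyX).2).1
    have hyb' : y ≠ b' := (mem_erase.1 (mem_erase.1 (mem_erase.1 hyX).2).2).1
    exact starNineSharp_instance_of_parallel_twin hn hR hcf h hf hyg hyf.symm (hpt f hf) (hpt y hyg) hfy hef hye.symm
      hfb'.symm hyb'.symm
  push Not at hB
  have hf1 : ∀ y ∈ ((((gr N).erase b).erase b').erase f).erase e, rk N {f, y} = 2 := by
    intro y hyX
    exact (hpair f hf y (hXg hyX) (mem_erase.1 (mem_erase.1 hyX).2).1.symm).resolve_left (hB y hyX)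
  -- CASE D1: `e` has a parallel twin in `X`
  by_cases hD1 : ∃ x ∈ ((((gr N).erase b).erase b').erase f).erase e, rk N {e, x} = 1
  · obtain ⟨x, hxX, hex⟩ := hD1
    have hxg : x ∈ gr N := hXg hxX
    have hxe : x ≠ e := (mem_erase.1 hxX).1
    have hxf : x ≠ f := (mem_erase.1 (mem_erase.1 hxX).2).1
    have hxb' : x ≠ b' := (mem_erase.1 (mem_erase.1 (mem_erase.1 hxX).2).2).1
    have hxb : x ≠ b := (mem_erase.1 (mem_erase.1 (mem_erase.1 (mem_erase.1 hxX).2).2).2).1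
    exact starNineSharp_instance_of_parallel_twin_e hn h he hxg hf hxe.symm hef hxf heb heb' hxb hxb' hfb hfb' (hpt e he)
      (hpt x hxg) hex hf'
  push Not at hD1
  have he1 : ∀ y ∈ ((((gr N).erase b).erase b').erase f).erase e, rk N {e, y} = 2 := by
    intro y hyX
    exact (hpair e he y (hXg hyX) (mem_erase.1 hyX).1.symm).resolve_left (hD1 y hyX)
  -- CASE A-ser: `{e, f}` a series pair of `R`
  by_cases hAs : rk N (((((gr N).erase b).erase b').erase f).erase e) = 3
  · exact inCount_thru_le_of_series_ef hn hR hcf h he hf hef heb heb' hfb hfb' hAs hf' he'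
  have hX : rk N (((((gr N).erase b).erase b').erase f).erase e) = 4 := by
    have heEf : e ∈ (((gr N).erase b).erase b').erase f := mem_erase.2 ⟨hef, heE⟩
    have h1 := rk_insert_le_add_one (N := N) he (X := ((((gr N).erase b).erase b').erase f).erase e) hXg
    rw [insert_erase heEf, hf'] at h1
    have h2 : rk N (((((gr N).erase b).erase b').erase f).erase e) ≤ rk N ((((gr N).erase b).erase b').erase f) :=
      rk_mono' (erase_subset _ _)
    rw [hf'] at h2
    omega
  -- CASE C: `f` has a series twin `z ∈ X` (a coloop of `R`, or not)
  by_cases hC : ∃ z ∈ ((((gr N).erase b).erase b').erase f).erase e,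
      rk N (((((gr N).erase b).erase b').erase f).erase z) = 3
  · obtain ⟨z, hzX, hH⟩ := hC
    have hzg : z ∈ gr N := hXg hzX
    have hze : z ≠ e := (mem_erase.1 hzX).1
    have hzf : z ≠ f := (mem_erase.1 (mem_erase.1 hzX).2).1
    have hzb' : z ≠ b' := (mem_erase.1 (mem_erase.1 (mem_erase.1 hzX).2).2).1
    have hzb : z ≠ b := (mem_erase.1 (mem_erase.1 (mem_erase.1 (mem_erase.1 hzX).2).2).2).1
    have hzE : z ∈ ((gr N).erase b).erase b' := (erase_subset _ _) ((erase_subset _ _) hzX)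
    by_cases hzR : rk N ((((gr N).erase b).erase b').erase z) = 3
    · exact inCount_thru_le_of_coloop_X hn hR hcf h hf hfb hfb' hE7 hzX hzR
    · have hz' : rk N ((((gr N).erase b).erase b').erase z) = 4 := by
        have h1 := rk_insert_le_add_one (N := N) hzg (X := (((gr N).erase b).erase b').erase z)
          ((erase_subset _ _).trans hE7g)
        rw [insert_erase hzE, hE7] at h1
        have h2 : rk N ((((gr N).erase b).erase b').erase z) ≤ rk N (((gr N).erase b).erase b') :=
          rk_mono' (erase_subset _ _)
        rw [hE7] at h2
        omega
      exact inCount_thru_le_of_seriesTwin hn hR hcf h hf hzg hef hze.symm hzf.symm heb hfb hfb' hzb hzb' hH hf' hz'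
  push Not at hC
  have hfc : ∀ y ∈ ((((gr N).erase b).erase b').erase f).erase e,
      rk N (((((gr N).erase b).erase b').erase f).erase y) = 4 := by
    intro y hyX
    have hyEf : y ∈ (((gr N).erase b).erase b').erase f := mem_of_mem_erase hyX
    have h1 := rk_insert_le_add_one (N := N) (hXg hyX) (X := ((((gr N).erase b).erase b').erase f).erase y)
      ((erase_subset _ _).trans ((erase_subset _ _).trans hE7g))
    rw [insert_erase hyEf, hf'] at h1
    have h2 : rk N (((((gr N).erase b).erase b').erase f).erase y) ≤ rk N ((((gr N).erase b).erase b').erase f) :=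
      rk_mono' (erase_subset _ _)
    rw [hf'] at h2
    have := hC y hyX
    omega
  -- CASE D0: the generic case
  exact inCount_thru_le_of_D0 hn hR hcf h he hf hef heb heb' hfb hfb' hE7 he1 hf1 hfc hX hef2

end StarSharpAsmC

end PercRepro.Cogirth
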